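import Literature.Computability.AlgebraicComplexity.DeterminantalComplexityProofs
import Literature.Computability.AlgebraicComplexity.AlperBogartVelascoProofs
import Summits.ValiantsHypothesis.ValiantsHypothesis.Theorems.DetQPDetqpThesisStubDeletion

/-!
# `DetqpThesis` (stmt-ValiantsHypothesis-0315), line `fat-row-recursion` — S7: ratio surgery
# (the line's unconditional theorem, in tree vocabulary)

A ROW-PARTITIONED affine determinantal representation of `per_n = perPoly (Fin n) ℂ` of size `M`
is an affine determinantal representation `A` (`IsAffineDetRepr`) together with
`β : Fin M → Fin n` such that matrix row `a` reads only the variables `X (•, β a)`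
(`coeff (single e 1) (A a b) ≠ 0 → e.2 = β a`); block `c` is `{a | β a = c}`, of size `u_c`.

The deletion stub S2 (`FatRowDeletion.stub_deletion`, landed) removes any column block `j` of a
row-partitioned representation of `per_{n+1}` of size `M` and leaves a row-partitioned
representation of `per_n` of size `≤ M − u_j`.  Deleting the LARGEST block (pigeonhole:
`(n+1)·u_max ≥ M`) gives the line's one unconditional theorem:

* `stub_ratioSurgery` — every row-partitioned representation of `per_{n+1}` of size `M` yields one
  of `per_n` of size `M'` with `(n+1)·M' ≤ n·M`; i.e. the row-partitioned determinantal complexity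
  `r(n)` of the permanent satisfies `r(n)/n ≤ r(n+1)/(n+1)` (with `dc(per_n) ≤ r(n) ≤ n·dc(per_n)`
  by S1).
* `no_rowPartitioned_perPoly_four_le_nine` — with `dc(per_3) = 7` (Alper–Bogart–Velasco): `per_4`
  has no row-partitioned representation of size `≤ 9` (`r(4) ≥ 10`; Grenet gives `r(4) ≤ 15`),
  although `dc(per_4) ≥ 9` is all that is known for unrestricted representations.

Sources: folklore surgery on determinantal representations; J. Alper, T. Bogart, M. Velasco,
*A lower bound for the determinantal complexity of a hypersurface*, FoCM 17 (2017), Cor. 1.4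
(key `AlperBogartVelasco2017`).  Not here: the bet of the line (fat blocks) and its calibration.
-/

-- single-conjunct layout: Sub = Summit, duplicated namespace component intended
set_option linter.dupNamespace false

noncomputable section

namespace Summit.ValiantsHypothesis.ValiantsHypothesis.Theorems.DetQPDetqpThesis.FatRowRatio

open MvPolynomial Finset
open Literature.Computability.AlgebraicComplexity

/-- Pigeonhole for a colouring `β : Fin M → Fin (n+1)`: some colour class has
`(n+1)·|class| ≥ M`. [folklore] -/
theorem exists_large_fiber {M n : ℕ} (β : Fin M → Fin (n + 1)) :
    ∃ j : Fin (n + 1), M ≤ (n + 1) * (Finset.univ.filter fun a => β a = j).card := by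
  have hsum : ∑ j : Fin (n + 1), (Finset.univ.filter fun a => β a = j).card = M := by
    have h := Finset.card_eq_sum_card_fiberwise (f := β) (s := Finset.univ) (t := Finset.univ)
      (fun a _ => Finset.mem_univ (β a))
    simpa using h.symm
  by_contra hcon
  push Not at hcon
  have hlt : ∑ j : Fin (n + 1), (n + 1) * (Finset.univ.filter fun a => β a = j).card <
      ∑ _j : Fin (n + 1), M :=
    Finset.sum_lt_sum_of_nonempty Finset.univ_nonempty fun j _ => hcon j
  rw [← Finset.mul_sum, hsum, Finset.sum_const, Finset.card_univ, Fintype.card_fin,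
    smul_eq_mul] at hlt
  exact lt_irrefl _ hlt

/-- **Registered stub `stub_ratioSurgery` (S7): ratio surgery.**  Every row-partitioned affine
determinantal representation of `per_{n+1}` of size `M` (`n ≥ 1`) yields a row-partitioned
representation of `per_n` of size `M'` with `(n+1)·M' ≤ n·M` — delete the largest column block
(`exists_large_fiber`) with the exact deletion surgery `FatRowDeletion.stub_deletion`.  Equivalently,
`r(n)/n` is non-decreasing for the row-partitioned determinantal complexity `r` of the permanent.
[folklore] -/
theorem stub_ratioSurgery :
    ∀ (n : ℕ), 1 ≤ n →
      ∀ (M : ℕ) (A : Matrix (Fin M) (Fin M) (MvPolynomial (Fin (n + 1) × Fin (n + 1)) ℂ))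
        (β : Fin M → Fin (n + 1)),
        IsAffineDetRepr (perPoly (Fin (n + 1)) ℂ) A →
        (∀ a b (e : Fin (n + 1) × Fin (n + 1)), coeff (Finsupp.single e 1) (A a b) ≠ 0 → e.2 = β a) →
        ∃ M' : ℕ, (n + 1) * M' ≤ n * M ∧
          ∃ (A' : Matrix (Fin M') (Fin M') (MvPolynomial (Fin n × Fin n) ℂ)) (β' : Fin M' → Fin n),
            IsAffineDetRepr (perPoly (Fin n) ℂ) A' ∧
            ∀ a b (e : Fin n × Fin n), coeff (Finsupp.single e 1) (A' a b) ≠ 0 → e.2 = β' a := by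
  intro n hn M A β hA hβ
  obtain ⟨j, hj⟩ := exists_large_fiber β
  obtain ⟨M', hM', A', β', hA', hβ'⟩ := FatRowDeletion.stub_deletion n hn M A β hA hβ j
  refine ⟨M', ?_, A', β', hA', hβ'⟩
  -- `(n+1)·M' ≤ (n+1)·(M − u_j) = (n+1)·M − (n+1)·u_j ≤ (n+1)·M − M = n·M`
  nlinarith

/-- **`r(4) ≥ 10`: `per_4` has no row-partitioned affine determinantal representation of size
`≤ 9`** — ratio surgery would produce one of `per_3` of size `M'` with `4·M' ≤ 27`, i.e.
`M' ≤ 6 < 7 = dc(per_3)` (Alper–Bogart–Velasco).  For unrestricted representations only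
`dc(per_4) ≥ 9` is known. [cite: AlperBogartVelasco2017, Corollary 1.4] -/
theorem no_rowPartitioned_perPoly_four_le_nine {M : ℕ} (hM : M ≤ 9)
    (A : Matrix (Fin M) (Fin M) (MvPolynomial (Fin 4 × Fin 4) ℂ)) (β : Fin M → Fin 4)
    (hA : IsAffineDetRepr (perPoly (Fin 4) ℂ) A)
    (hβ : ∀ a b (e : Fin 4 × Fin 4), coeff (Finsupp.single e 1) (A a b) ≠ 0 → e.2 = β a) :
    False := by
  obtain ⟨M', hM', A', β', hA', -⟩ := stub_ratioSurgery 3 (by norm_num) M A β hA hβ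
  have h7 : 7 ≤ determinantalComplexity (perPoly (Fin 3) ℂ) :=
    AlperBogartVelasco.seven_le_determinantalComplexity_perPoly_three ℂ two_ne_zero
  have hle : determinantalComplexity (perPoly (Fin 3) ℂ) ≤ M' :=
    determinantalComplexity_le_of_hasDetRepr ⟨A', hA'⟩
  omega

end Summit.ValiantsHypothesis.ValiantsHypothesis.Theorems.DetQPDetqpThesis.FatRowRatio

end
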